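import Mathlib
import HarnessLib
import Literature.AlgebraicGeometry.Morphisms.IsoOverOpen
import Literature.AlgebraicGeometry.GroupActions.KollarSzaboGoingDown
import Summits.ResolutionOfSingularities.ResolutionOfSingularities.Theorems.WildQuotientsWildQuotientResolutionKSGoingDownInduction

/-!
# Kollár–Szabó going down, (K5): the named fact `KollarSzaboGoingDown` from the abstract blow-up step
# (crux `WildQuotients.WildQuotientResolution`, stub `stub_phaseZeroHighDim`)

Crux stmt-ResolutionOfSingularities-15640 (`WildQuotientResolution`), registered stub `stub_phaseZeroHighDim`;
programme (hand 8-g0, memo PHASE0-KS-EIGENLINE.md): discharge the named fact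
`Literature.AlgebraicGeometry.GroupActions.KollarSzaboGoingDown` behind ✓p824255.

✓`KSGoingDown.goingDown_of_step` (p828107) proves the RATIONAL-MAP form for every dimension from the
abstract blow-up step `hstep`. This file performs the remaining glue (K5a) from the MORPHISM form of the
named fact: for `π : Y → X` proper, birational and `H`-equivariant, the inverse of `π` over the `H`-stable
dense open `W = ⋂_h σ_h⁻¹(U)` (`U` an open over which `π` is an isomorphism, `IsBirational`) is an
`H`-EQUIVARIANT section `W → Y` (two lifts through the isomorphism `π|_W` agree), to which the rational-map
form applies. Hence

* `kollarSzaboGoingDown_of_step : hstep → KollarSzaboGoingDown` — **the named fact is reduced to the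
  equivariant point blow-up with its exceptional divisor** ((K2)/(K4): `X̃ = Bl_x X` integral with the
  lifted action and `b : X̃ → X` dominant equivariant; `η` = generic point of `E`, a valuation ring in
  `X̃`; `E ≅ ℙ(T_x X)` integral, separated of finite type over `K`, with its linear `H`-action, the
  equivariant closed immersion `i : E → X̃` over `X`, and an `H`-fixed closed point `x₁ ∈ E` — an
  eigenline, ✓`AbelianEigenlineStalk` — with `𝒪_{E,x₁}` regular of dimension `dim 𝒪_{X,x} - 1`).

* `inv_morphismRestrict_equivariant` — the equivariance of the inverse section over a stable open.
* `preimage_iInter_stable`, `genericPoint_mem_iInter` — the stable open `W` and its non-emptiness.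

[OURS · crux stmt-ResolutionOfSingularities-15640 · helper toward `stub_phaseZeroHighDim` (conditional
discharge of a named fact; NOT a proof of the stub); counted 0; AI-level work, weaker than expert review.]
[cite: ReichsteinYoussin2000, Appendix (Kollár–Szabó), Prop. A.2 and its proof]
-/

-- single-problem summit: the doubled namespace component `ResolutionOfSingularities` is forced
set_option linter.dupNamespace false

noncomputable section

open CategoryTheory CategoryTheory.Limits AlgebraicGeometry TopologicalSpace IsLocalRing
open Literature.AlgebraicGeometry.Ramification Literature.AlgebraicGeometry.Resolution
open Literature.AlgebraicGeometry.Morphisms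

namespace Summit.ResolutionOfSingularities.ResolutionOfSingularities.Theorems.WildQuotientResolution.KSGoingDown

universe u v

/-! ## The equivariant section over a stable open of the iso locus -/

section Section

variable {X Y : Scheme.{u}} {G : Type v} [Group G] (σ : G →* Aut X) (τ : G →* Aut Y)
  (π : Y ⟶ X) (hπ : ∀ g, (τ g).hom ≫ π = π ≫ (σ g).hom)

omit hπ in
/-- The inverse section `s = (π|_W)⁻¹ ≫ ι : W → Y` over an open `W` over which `π` is an isomorphism
satisfies `s ≫ π = W ↪ X`. [folklore] -/
theorem inv_morphismRestrict_comp {W : X.Opens} [IsIso (π ∣_ W)] :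
    (inv (π ∣_ W) ≫ (π ⁻¹ᵁ W).ι) ≫ π = W.ι := by
  rw [Category.assoc, ← morphismRestrict_ι, IsIso.inv_hom_id_assoc]

include hπ in
/-- **The inverse section over a `G`-stable open of the iso locus is `G`-equivariant**: with
`s = (π|_W)⁻¹ ≫ ι : W → Y`, `σ_g|_W ≫ s = s ≫ τ_g` — both sides are lifts of `W ↪ X —σ_g→ X` through
`π`, land in `π⁻¹(W)`, and `π|_W` is a monomorphism. [folklore] -/
theorem inv_morphismRestrict_equivariant {W : X.Opens} (hW : ∀ g, (σ g).hom ⁻¹ᵁ W = W)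
    [IsIso (π ∣_ W)] (g : G) :
    (σ g).hom.resLE W W (hW g).ge ≫ (inv (π ∣_ W) ≫ (π ⁻¹ᵁ W).ι) =
      (inv (π ∣_ W) ≫ (π ⁻¹ᵁ W).ι) ≫ (τ g).hom := by
  set s : (W : Scheme.{u}) ⟶ Y := inv (π ∣_ W) ≫ (π ⁻¹ᵁ W).ι with hs
  have hsπ : s ≫ π = W.ι := inv_morphismRestrict_comp π
  -- both sides lie over `W ↪ X —σ_g→ X`
  have ha : ((σ g).hom.resLE W W (hW g).ge ≫ s) ≫ π = W.ι ≫ (σ g).hom := by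
    rw [Category.assoc, hsπ, Scheme.Hom.resLE_comp_ι]
  have hc : (s ≫ (τ g).hom) ≫ π = W.ι ≫ (σ g).hom := by
    rw [Category.assoc, hπ, ← Category.assoc, hsπ]
  -- hence both land in `π⁻¹(W)` (as `W` is stable)
  have hrange : ∀ (a : (W : Scheme.{u}) ⟶ Y), a ≫ π = W.ι ≫ (σ g).hom →
      Set.range a.base ⊆ Set.range (π ⁻¹ᵁ W).ι.base := by
    intro a haπ
    rintro _ ⟨z, rfl⟩
    rw [Scheme.Opens.range_ι]
    change π.base (a.base z) ∈ W
    rw [← Scheme.Hom.comp_apply, haπ, Scheme.Hom.comp_apply, Scheme.Opens.ι_apply]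
    have hz : z.val ∈ (σ g).hom ⁻¹ᵁ W := by rw [hW]; exact z.2
    exact hz
  -- two lifts through the monomorphism `π|_W` agree
  have key : ∀ (a c : (W : Scheme.{u}) ⟶ Y), a ≫ π = W.ι ≫ (σ g).hom → c ≫ π = W.ι ≫ (σ g).hom →
      a = c := by
    intro a c haπ hcπ
    have ea := IsOpenImmersion.lift_fac (π ⁻¹ᵁ W).ι a (hrange a haπ)
    have ec := IsOpenImmersion.lift_fac (π ⁻¹ᵁ W).ι c (hrange c hcπ)
    rw [← ea, ← ec]
    congr 1
    rw [← cancel_mono (π ∣_ W), ← cancel_mono W.ι, Category.assoc, Category.assoc, morphismRestrict_ι,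
      ← Category.assoc, ← Category.assoc, ea, ec, haπ, hcπ]
  exact key _ _ ha hc

end Section

/-! ## The stable open `W = ⋂_g σ_g⁻¹(U)` -/

section StableOpen

variable {X : Scheme.{u}} {G : Type v} [Group G] [Finite G] (σ : G →* Aut X)

omit [Finite G] in
/-- `σ_{g} (σ_{h} z) = σ_{g h}`-bookkeeping: `(σ (g * h)) z = (σ g) ((σ h) z)`… in `Aut X` the product is
composition in the reverse order, so `(σ (g * h)).hom = (σ h).hom ≫ (σ g).hom`. [folklore] -/
theorem aut_mul_hom_base (g h : G) (z : X) :
    (σ (g * h)).hom.base z = (σ g).hom.base ((σ h).hom.base z) := by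
  rw [map_mul, Aut.Aut_mul_def, Iso.trans_hom, Scheme.Hom.comp_apply]

/-- **The intersection of the translates of an open is a `G`-stable open** (finite `G`). [folklore] -/
theorem preimage_iInter_stable (U : X.Opens) (g : G) :
    (σ g).hom ⁻¹ᵁ (⟨⋂ h : G, (((σ h).hom ⁻¹ᵁ U : X.Opens) : Set X),
        isOpen_iInter_of_finite fun h => ((σ h).hom ⁻¹ᵁ U).2⟩ : X.Opens) =
      ⟨⋂ h : G, (((σ h).hom ⁻¹ᵁ U : X.Opens) : Set X),
        isOpen_iInter_of_finite fun h => ((σ h).hom ⁻¹ᵁ U).2⟩ := by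
  ext z
  change (σ g).hom.base z ∈ ⋂ h : G, (((σ h).hom ⁻¹ᵁ U : X.Opens) : Set X) ↔
    z ∈ ⋂ h : G, (((σ h).hom ⁻¹ᵁ U : X.Opens) : Set X)
  simp only [Set.mem_iInter]
  constructor
  · intro hz h
    have := hz (h * g⁻¹)
    change (σ (h * g⁻¹)).hom.base ((σ g).hom.base z) ∈ U at this
    rw [← aut_mul_hom_base, inv_mul_cancel_right] at this
    exact this
  · intro hz h
    change (σ h).hom.base ((σ g).hom.base z) ∈ U
    rw [← aut_mul_hom_base]
    exact hz (h * g)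

omit [Finite G] in
/-- The generic point of an irreducible scheme lies in every translate of a non-empty open.
[folklore] -/
theorem genericPoint_mem_iInter [IrreducibleSpace X] (U : X.Opens) (hU : (U : Set X).Nonempty) :
    genericPoint X ∈ ⋂ h : G, (((σ h).hom ⁻¹ᵁ U : X.Opens) : Set X) := by
  refine Set.mem_iInter.mpr fun h => ?_
  refine ((genericPoint_spec X).mem_open_set_iff ((σ h).hom ⁻¹ᵁ U).2).mpr ?_
  obtain ⟨u, hu⟩ := hU
  refine ⟨(σ h⁻¹).hom.base u, Set.mem_univ _, ?_⟩
  change (σ h).hom.base ((σ h⁻¹).hom.base u) ∈ U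
  rw [← aut_mul_hom_base, mul_inv_cancel, map_one]
  exact hu

end StableOpen

/-! ## The named fact from the blow-up step -/

/-- **Kollár–Szabó «going down» (the named fact `KollarSzaboGoingDown`, Reichstein–Youssin 2000, App.,
Prop. A.2, morphism form) FROM THE ABSTRACT BLOW-UP STEP** `hstep` of ✓`goingDown_of_step` (the
equivariant point blow-up with its exceptional divisor, items (K2)/(K4) of the programme). Proof: take
an open `U` over which the proper birational equivariant `π` is an isomorphism, the `H`-stable open
`W = ⋂_h σ_h⁻¹(U) ∋ ξ_X`, the equivariant inverse section `W → Y` (`inv_morphismRestrict_equivariant`),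
and apply the rational-map form `goingDown_of_step` at `n = dim 𝒪_{X,x}`.
[cite: ReichsteinYoussin2000, Appendix (Kollár–Szabó), Prop. A.2] -/
theorem kollarSzaboGoingDown_of_step
    (hstep : ∀ (K : Type) [Field K] [IsAlgClosed K] (X : Scheme.{0}) (sX : X ⟶ Spec (.of K))
      [IsIntegral X] [IsSeparated sX] [LocallyOfFiniteType sX] [QuasiCompact sX]
      (H : Type) [CommGroup H] [Finite H] (σ : H →* Aut X), (∀ h, (σ h).hom ≫ sX = sX) →
      ∀ (x : X), IsClosed ({x} : Set X) → IsRegularLocalRing (X.presheaf.stalk x) →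
      (∀ h, h ∈ inertiaSubgroup σ x) → ∀ n : ℕ, ringKrullDim (X.presheaf.stalk x) = (n + 1 : ℕ) →
      ∃ (X' : Scheme.{0}) (_ : IsIntegral X') (σ' : H →* Aut X') (b : X' ⟶ X) (_ : IsDominant b)
        (_ : ∀ h, (σ' h).hom ≫ b = b ≫ (σ h).hom) (η : X') (_ : ValuationRing (X'.presheaf.stalk η))
        (E : Scheme.{0}) (sE : E ⟶ Spec (.of K)) (_ : IsIntegral E) (_ : IsSeparated sE)
        (_ : LocallyOfFiniteType sE) (_ : QuasiCompact sE) (σE : H →* Aut E)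
        (_ : ∀ h, (σE h).hom ≫ sE = sE) (i : E ⟶ X') (_ : ∀ h, (σE h).hom ≫ i = i ≫ (σ' h).hom)
        (_ : i ≫ b ≫ sX = sE) (_ : η ∈ Set.range i.base) (x₁ : E),
        IsClosed ({x₁} : Set E) ∧ IsRegularLocalRing (E.presheaf.stalk x₁) ∧
        (∀ h, h ∈ inertiaSubgroup σE x₁) ∧ ringKrullDim (E.presheaf.stalk x₁) = n) :
    Literature.AlgebraicGeometry.GroupActions.KollarSzaboGoingDown := by
  intro K _ _ X Y sX _ _ _ _ _ π _ hbir H _ _ σ τ hσ hτ x hxcl hreg hfix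
  obtain ⟨U, hUd, -, hUiso⟩ := hbir
  -- the stable open `W = ⋂_h σ_h⁻¹(U)` and the equivariant inverse section over it
  let W : X.Opens := ⟨⋂ h : H, (((σ h).hom ⁻¹ᵁ U : X.Opens) : Set X),
    isOpen_iInter_of_finite fun h => ((σ h).hom ⁻¹ᵁ U).2⟩
  have hWst : ∀ g, (σ g).hom ⁻¹ᵁ W = W := preimage_iInter_stable σ U
  have hWU : W ≤ U := by
    intro z hz
    have h1 := Set.mem_iInter.mp hz 1
    rwa [map_one] at h1
  have hWne : (W : Set X).Nonempty := ⟨genericPoint X, genericPoint_mem_iInter σ U hUd.nonempty⟩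
  haveI : IsIso (π ∣_ W) := isIso_morphismRestrict_of_le π hWU
  let s : (W : Scheme.{0}) ⟶ Y := inv (π ∣_ W) ≫ (π ⁻¹ᵁ W).ι
  have hs : s ≫ (π ≫ sX) = W.ι ≫ sX := by
    rw [← Category.assoc, inv_morphismRestrict_comp π]
  have hseq : ∀ h, (σ h).hom.resLE W W (hWst h).ge ≫ s = s ≫ (τ h).hom :=
    inv_morphismRestrict_equivariant σ τ π hτ hWst
  -- the dimension of `𝒪_{X,x}` and the rational-map form
  haveI := hreg
  obtain ⟨n, hn⟩ := Literature.AlgebraicGeometry.Resolution.ringKrullDim_eq_nat (X.presheaf.stalk x)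
  exact goingDown_of_step hstep n K X sX H σ hσ x hxcl hreg hfix hn.le Y (π ≫ sX) τ W hWne hWst s hs hseq

end Summit.ResolutionOfSingularities.ResolutionOfSingularities.Theorems.WildQuotientResolution.KSGoingDown

end
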